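import Literature.Computability.Cryptography.RegevSamplerDecode
import Literature.Computability.Cryptography.RegevSamplerScale
import Literature.Computability.Cryptography.RegevStageKernelLaws
import Literature.Computability.Cryptography.RegevBDDToLWESample
import HarnessLib

/-!
# Regev 2009, Lemma 3.14 in machine form: from the event bound to the output law on integer vectors

Topic `Computability/Cryptography` (family `pqc`), grouping namespace `Regev2009.SamplerDecode`
(continued); sequel of `RegevSamplerDecode.lean` (the decoder `dec w = t⁻¹ Σⱼ valMinAbs(wⱼ) bⱼ` of the
measured frequencies) and `RegevSamplerScale.lean` (`D_{L_t, t⁻¹r} = (t⁻¹•)_* D_{L(B), r}`). The law of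
the quantum part of Regev's sampler (J. ACM 56 (2009), art. 34, Lemma 3.14; in this tree
`QPart.law_bound_of_basis`) is an EVENT-WISE bound in rescaled units,
`∀ A ⊆ ℝⁿ, |Pr[dec(read) ∈ A] − D_{L_t, 1/√2}({x | x ∈ A})| ≤ ε`, whereas the reduction's step family
(`regev2009_lemma_3_14_stepFamily`) speaks of the statistical distance between the law of the
INTEGER VECTOR written on the output register and `D_{L(B), r} ∘ intCoords⁻¹`, `r = t/√2`. This file
is the bridge:

* `decZ I R w` — the integer coordinates `(Σⱼ valMinAbs(wⱼ) Bⱼᵢ)ᵢ` of the output lattice point (what the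
  sampler's classical tail writes), `intVecToEuclidean_decZ` (`= Σⱼ valMinAbs(wⱼ) bⱼ = t • dec w`);
* **`tvDist_map_decZ_le`** — for ANY law `μ` of the machine's raw outcomes and readout `rd`: the
  event-wise bound for `dec ∘ rd` against `D_{L_t, 1/√2}` gives
  `Δ((decZ ∘ rd)_* μ ; intCoords_* D_{L(B), t/√2}) ≤ ε`.

Everything is proved; definitions have bodies; no named fact is introduced.

## References

* O. Regev, *On lattices, learning with errors, random linear codes, and cryptography*, J. ACM 56
  (2009), art. 34; author's version arXiv:2401.03703: Lemma 3.14 (statement: "output a sample from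
  `D_{L,√n/(√2 d)}`"), p. 20 [Regev2009].
* D. Micciancio, S. Goldwasser, *Complexity of Lattice Problems*, Kluwer 2002, Ch. 1 §1 (integer lattices)
  [MicciancioGoldwasser2002].
-/

noncomputable section

namespace Literature.Computability.Cryptography

namespace Regev2009

namespace SamplerDecode

open Literature.Algebra.EuclideanLattices Peikert2009 Finset SamplerArith SamplerScale
open scoped InnerProductSpace

variable (I : LatticeInstance) (R : ℕ)

/-! ### The output integer vector -/

/-- **The output integer vector**: the coordinates `(Σⱼ valMinAbs(wⱼ) Bⱼᵢ)ᵢ ∈ ℤⁿ` of the lattice point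
`Σⱼ valMinAbs(wⱼ) bⱼ` named by the measured frequencies. [cite: Regev2009, Lemma 3.14 (proof, last step)] -/
def decZ (w : Fin I.n → ZMod R) : Fin I.n → ℤ := fun i => ∑ j, (w j).valMinAbs * I.basis j i

/-- `decZ w`, as a point of `ℝⁿ`, is `Σⱼ valMinAbs(wⱼ) bⱼ`. [folklore] -/
theorem intVecToEuclidean_decZ (w : Fin I.n → ZMod R) :
    intVecToEuclidean I.n (decZ I R w) = ∑ j, ((w j).valMinAbs : ℝ) • I.vec j := by
  ext i
  rw [intVecToEuclidean_apply, decZ, WithLp.ofLp_sum, Finset.sum_apply]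
  push_cast
  refine sum_congr rfl fun j _ => ?_
  rw [WithLp.ofLp_smul, Pi.smul_apply, smul_eq_mul, ← LatticeInstance.vec_apply]

/-- `decZ w` is a point of `L(B)`. [folklore] -/
theorem intVecToEuclidean_decZ_mem (w : Fin I.n → ZMod R) : intVecToEuclidean I.n (decZ I R w) ∈ I.lattice := by
  rw [intVecToEuclidean_decZ, LatticeInstance.lattice]
  refine Submodule.sum_mem _ fun j _ => ?_
  rw [Int.cast_smul_eq_zsmul ℝ]
  exact Submodule.smul_mem _ _ (Submodule.subset_span ⟨j, rfl⟩)

/-- **`t • dec w = decZ w`** (as points of `ℝⁿ`). [folklore] -/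
theorem smul_dec_eq (t : ℝ) (ht : t ≠ 0) (w : Fin I.n → ZMod R) :
    t • dec I t R w = intVecToEuclidean I.n (decZ I R w) := by
  rw [dec, smul_smul, mul_inv_cancel₀ ht, one_smul, intVecToEuclidean_decZ]

/-- `dec w = t⁻¹ • decZ w`. [folklore] -/
theorem dec_eq_inv_smul (t : ℝ) (w : Fin I.n → ZMod R) :
    dec I t R w = t⁻¹ • intVecToEuclidean I.n (decZ I R w) := by
  rw [dec, intVecToEuclidean_decZ]

/-! ### From events in rescaled units to the law of the integer output -/

/-- The event of `ℝⁿ` (rescaled units) corresponding to a set of integer vectors. [folklore] -/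
def evT (t : ℝ) (S : Set (Fin I.n → ℤ)) : Set (EuclideanSpace ℝ (Fin I.n)) :=
  {x | ∃ k ∈ S, x = t⁻¹ • intVecToEuclidean I.n k}

/-- `dec w ∈ evT S ↔ decZ w ∈ S`. [folklore] -/
theorem dec_mem_evT_iff {t : ℝ} (ht : t ≠ 0) (S : Set (Fin I.n → ℤ)) (w : Fin I.n → ZMod R) :
    dec I t R w ∈ evT I t S ↔ decZ I R w ∈ S := by
  rw [dec_eq_inv_smul]
  constructor
  · rintro ⟨k, hk, h⟩
    have h' := intVecToEuclidean_injective I.n (smul_right_injective _ (inv_ne_zero ht) h)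
    rwa [h']
  · intro h
    exact ⟨_, h, rfl⟩

/-- `t⁻¹ y ∈ evT S ↔ intCoords y ∈ S` for `y ∈ L(B)`. [folklore] -/
theorem inv_smul_mem_evT_iff {t : ℝ} (ht : t ≠ 0) (S : Set (Fin I.n → ℤ)) (y : I.lattice) :
    t⁻¹ • (y : EuclideanSpace ℝ (Fin I.n)) ∈ evT I t S ↔ I.intCoords y ∈ S := by
  constructor
  · rintro ⟨k, hk, h⟩
    have h' : (y : EuclideanSpace ℝ (Fin I.n)) = intVecToEuclidean I.n k := smul_right_injective _ (inv_ne_zero ht) h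
    rw [← LatticeInstance.intVecToEuclidean_intCoords I y] at h'
    rwa [intVecToEuclidean_injective I.n h']
  · intro h
    exact ⟨_, h, by rw [LatticeInstance.intVecToEuclidean_intCoords]⟩

/-- **From the event bound in rescaled units to the output law.** For any law `μ` of raw outcomes
and any readout `rd` of the frequency register: if for every `A ⊆ ℝⁿ`
`|μ{dec(rd) ∈ A} − D_{L_t,1/√2}{x ∈ A}| ≤ ε` (`L_t = t⁻¹L(B)`, `0 < t`), then the law of the integer
output `decZ ∘ rd` is within statistical distance `ε` of `intCoords_* D_{L(B), t/√2}`.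
[cite: Regev2009, Lemma 3.14 (statement: "a sample from `D_{L,√n/(√2 d)}`")] -/
theorem tvDist_map_decZ_le [IsZLattice ℝ I.lattice] {Ω : Type*} (μ : PMF Ω) (rd : Ω → Fin I.n → ZMod R)
    {t : ℝ} (ht : 0 < t) {ε : ℝ}
    (h : ∀ A : Set (EuclideanSpace ℝ (Fin I.n)),
      |(μ.toOuterMeasure {ω | dec I t R (rd ω) ∈ A}).toReal -
          ((discreteGaussian (scaledL I t ht.ne') (Real.sqrt 2)⁻¹ 0).toOuterMeasure
            {x : scaledL I t ht.ne' | (x : EuclideanSpace ℝ (Fin I.n)) ∈ A}).toReal| ≤ ε) :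
    (μ.map fun ω => decZ I R (rd ω)).tvDist ((discreteGaussian I.lattice (t / Real.sqrt 2) 0).map I.intCoords) ≤ ε := by
  refine PMF.tvDist_le_of_forall_toOuterMeasure_sub_le _ _ fun S => ?_
  have h1 : ((μ.map fun ω => decZ I R (rd ω)).toOuterMeasure S) = μ.toOuterMeasure {ω | dec I t R (rd ω) ∈ evT I t S} := by
    rw [PMF.toOuterMeasure_map_apply]
    congr 1
    ext ω
    exact (dec_mem_evT_iff I R ht.ne' S (rd ω)).symm
  have hr : 0 < t / Real.sqrt 2 := div_pos ht (Real.sqrt_pos.2 two_pos)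
  have h2 : ((discreteGaussian I.lattice (t / Real.sqrt 2) 0).map I.intCoords).toOuterMeasure S =
      (discreteGaussian (scaledL I t ht.ne') (Real.sqrt 2)⁻¹ 0).toOuterMeasure
        {x : scaledL I t ht.ne' | (x : EuclideanSpace ℝ (Fin I.n)) ∈ evT I t S} := by
    have hw : (Real.sqrt 2)⁻¹ = t⁻¹ * (t / Real.sqrt 2) := by
      rw [div_eq_mul_inv, ← mul_assoc, inv_mul_cancel₀ ht.ne', one_mul]
    have hval : {x : scaledL I t ht.ne' | (x : EuclideanSpace ℝ (Fin I.n)) ∈ evT I t S} = Subtype.val ⁻¹' evT I t S := rfl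
    rw [hval, ← PMF.toOuterMeasure_map_apply, hw, map_val_discreteGaussian_scaledL I ht hr,
      PMF.toOuterMeasure_map_apply, PMF.toOuterMeasure_map_apply]
    congr 1
    ext y
    exact (inv_smul_mem_evT_iff I ht.ne' S y).symm
  rw [h1, h2]
  exact (le_abs_self _).trans (h _)

end SamplerDecode

end Regev2009

end Literature.Computability.Cryptography

end
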